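import Literature.AnabelianGeometry.EtaleTheta.BiKummerGaloisSurjLaws
import Literature.AnabelianGeometry.EtaleTheta.Discharge.Sec4Prop43i
import Literature.AnabelianGeometry.EtaleTheta.Discharge.Sec4Prop42SubRefinement
import Literature.AnabelianGeometry.EtaleTheta.Discharge.Sec4GaloisSurjLawsModel
import Literature.AnabelianGeometry.EtaleTheta.Discharge.Sec4NonVacuityGaloisSurjLaws

/-!
# [EtTh] Proposition 4.3 (i) — the two residual base-level inputs of `prop43_i_of'` DISCHARGED from the
# naturality law `GaloisSurjNatural` of Def. 4.1 (ii); the named fact `Prop43_i` PROVED at the canonical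
# model setting over the genuine temperoid (every transport `pullFrac`), and at the toy setting

S. Mochizuki, *The étale theta function and its Frobenioid-theoretic manifestations*, Publ. RIMS **45**
(2009) [MochizukiEtTh2009], §4, Prop. 4.3 (i) p.90 (PDF; printed p.316), proof p.91: "there exist UNIQUE
group homomorphisms `s'_N{}^{gp}, s''_N{}^{gp} : H_{B_N} → Aut_C(B_N)` … [In particular, it follows that `B_N`
is `H_⊙`-ample.] … this follows from the fact that `H_⊙` acts trivially on `A_⊙^bs`."

PROOF-ONLY companion (no definition, no new named fact) of abc-iut-L2-t3's `BiKummerRoots.lean`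
(`BiKummerSetting.Prop43_i`, FACT-LIST row F-0492) for the F fact-proving wave (seat abc-iut-f-109).
abc-iut-L6-t12's `Discharge/Sec4Prop43i.lean` proved `Prop43_i` over the model Frobenioid modulo `Φ`
divisorial and the two printed BASE-LEVEL inputs
* `hα` — each trivializing section acts over `A^bs` trivially THROUGH `α` ("`H_⊙` acts trivially on
  `A_⊙^bs`"), and
* `hamp` — every element of `H_{B_N}^bs` is the transport along `Base(s'_N)` of the base of an element of
  `H_{A_N}` (used only for "[In particular, `B_N` is `H_⊙`-ample]"),
noting (note G2, 2026-08-25) that both concern the NATURALITY of the surjections `Π^tp_X ↠ Aut_D(−)`, which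
the hypothesis structure `BiKummerSetting` does not carry.  That naturality law has since been NAMED by the
owner as the predicate `BiKummerSetting.GaloisSurjNatural` (`BiKummerGaloisSurjLaws.lean`: along every base
morphism between Galois objects the representatives agree up to an inner automorphism of `Π^tp_X` — the
printed word "outer") and PROVED at the canonical model setting over the genuine temperoid `B^temp(Π^tp_X)`
(abc-iut-w5-d013: `galoisSurjOf_natural`; `mkOfModelCanonical_galoisSurjNatural`) and at the toy setting
(`Toy.biKummerSetting_galoisSurjNatural`).  This file closes the gap:
* `NthRoot.baseMap_striv_comp_α_of_galoisSurjNatural` — `hα` ⇐ `GaloisSurjNatural` (for roots of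
  fraction-pairs with domain `≅ A_⊙`: an element of `H_{A_N}` acts over ANY base morphism `A_N^bs → A_⊙^bs`
  trivially, `H_⊙ = Ker(Π^tp_X ↠ Aut_D(A_⊙^bs))` being NORMAL — abc-iut-w5-d231's `baseMap_comp_eq_of_mem_HA`);
* `NthRoot.exists_HA_base_comm_of_galoisSurjNatural` — `hamp` ⇐ `GaloisSurjNatural` + "`A_N` is
  `H_⊙`-ample" (part of "`A_N` is `(N, H_⊙, f|_{A_N})`-saturated", Def. 4.1 (iii), a field of `NthRoot`):
  conjugation by the base-isomorphism `Base(s'_N)` carries `H_{A_N}^bs` onto `H_{B_N}^bs` on the nose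
  (`hAbs_map_conjAut_of_natural`), and elements of `H_{A_N}^bs` lift to `Aut_C(A_N)`;
* `prop43_i_of_galoisSurjNatural` — **`Prop43_i` for EVERY transport `pullFrac`, from `Φ` divisorial and
  `GaloisSurjNatural` alone**; `prop43_i_of_isFrobenioid_of_galoisSurjNatural` (`Φ` divisorial from "`C` is a
  Frobenioid", [FrdI] Thm. 5.2 (ii)); `prop43_i_of_tree_of_galoisSurjNatural` (tree vocabulary: `Φ`
  divisorial is automatic);
* `prop43_i_mkOfModelCanonical` / `prop43_i_mkOfModelCanonical_tree` — **`Prop43_i` PROVED for the canonical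
  model setting over the genuine temperoid** fed with the temperoid's Galois data `(IsGaloisObj, galoisSurjOf)`
  (at the tree vocabulary: NO residual hypothesis; in general: `Φ` divisorial), every `pullFrac`;
* `Toy.prop43_i` — `Prop43_i` at the toy setting of `Sec4NonVacuity.lean`, every `pullFrac`.
So, as typed, [EtTh] Prop. 4.3 (i) is a THEOREM of {`BiKummerSetting` axioms, `Φ` divisorial, the outer
naturality of Def. 4.1 (ii)}; the universal closure over settings violating that naturality is not claimed.
HONEST FRAMING: refereed pre-IUT material ([EtTh] 2009); nothing here bears on, or takes a side on,
[IUTchIII] Cor. 3.12; proved = OUR kernel check of the typed statement.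
-/

noncomputable section

namespace Literature.AnabelianGeometry.EtaleTheta

open CategoryTheory Opposite Literature.AlgebraicGeometry.Frobenioids

universe u₀ v₀ u v w

variable {K : Type u₀} [Field K]

namespace BiKummerSetting

section Abstract

variable {X : SemiGraphs.TemperedArithmeticGroup.{u₀} K} {D₀ : Type u₀} [Category.{v₀} D₀]
  {V : FrdIMonoidStub.{w}} {T : RealifiedDivisorMonoids (D₀ := D₀) V} {D : Type u} [Category.{v} D]
  {VD : FrdICatStub.{u, v, w} D} {S : BiKummerSetting X T D VD}

namespace NthRoot

variable {A B : S.C} {f : S.biratUnits A} {P : S.FractionPair f B} {N : ℕ+}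
  {pullFrac : ∀ {A A' : S.C} (_ : A' ⟶ A), S.biratUnits A → S.biratUnits A'}
  (R : S.NthRoot f P N pullFrac)

/-- **The input `hα` of `prop43_i_of'` from the outer naturality of Def. 4.1 (ii)**: for an `N`-th root of
a fraction-pair with domain `A ≅ A_⊙` and a trivializing section `s_N^triv` over `H_{A_N}`, each
`s_N^triv(h)` acts over `A^bs` trivially through `α` — "`H_⊙` acts trivially on `A_⊙^bs`" (p.91): the base
of `h ∈ H_{A_N}` is the image of an element of the NORMAL subgroup `H_⊙ = Ker(Π^tp_X ↠ Aut_D(A_⊙^bs))`, so it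
acts trivially over any base morphism to `A_⊙^bs`, in particular over `Base(α) ≫ Base(A ≅ A_⊙)`.
[cite: MochizukiEtTh2009, Prop 4.3 (i) p.91] -/
theorem baseMap_striv_comp_α_of_galoisSurjNatural (hS : S.GaloisSurjNatural) (hA : S.IsGalois R.AN)
    (striv : S.HA R.AN hA →* Aut R.AN)
    (hstriv : ∀ h : S.HA R.AN hA, S.autBase R.AN (striv h) = S.autBase R.AN (h : Aut R.AN))
    (hAo : Nonempty (A ≅ S.Aodot)) (h : S.HA R.AN hA) :
    ModelFrobenioid.baseMap (striv h).hom ≫ ModelFrobenioid.baseMap R.α = ModelFrobenioid.baseMap R.α := by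
  obtain ⟨e⟩ := hAo
  have hb : ModelFrobenioid.baseMap (striv h).hom = ModelFrobenioid.baseMap (h : Aut R.AN).hom :=
    congrArg Iso.hom (hstriv h)
  have key := S.baseMap_comp_eq_of_mem_HA hS hA h.2 (ModelFrobenioid.baseMap (R.α ≫ e.hom))
  rw [ModelFrobenioid.baseMap_comp, ← Category.assoc] at key
  haveI : IsIso (ModelFrobenioid.baseMap e.hom) :=
    ⟨⟨ModelFrobenioid.baseMap e.inv,
      by rw [← ModelFrobenioid.baseMap_comp, e.hom_inv_id, ModelFrobenioid.baseMap_id],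
      by rw [← ModelFrobenioid.baseMap_comp, e.inv_hom_id, ModelFrobenioid.baseMap_id]⟩⟩
  rw [hb]
  exact (cancel_mono (ModelFrobenioid.baseMap e.hom)).mp key

/-- **The input `hamp` of `prop43_i_of'` from the outer naturality of Def. 4.1 (ii)** ("[In particular,
`B_N` is `H_⊙`-ample]", p.90): every element `g ∈ H_{B_N}^bs` is the transport along the base-isomorphism
`Base(s'_N) : A_N^bs ⥲ B_N^bs` of the base of an element of `H_{A_N} ⊆ Aut_C(A_N)` — conjugation by
`Base(s'_N)` carries `H_{A_N}^bs` onto `H_{B_N}^bs` ON THE NOSE (the inner ambiguity is invisible on the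
normal subgroup `H_⊙`), and `A_N` is `H_⊙`-ample (it is `(N, H_⊙, f|_{A_N})`-saturated, Def. 4.1 (iii)).
[cite: MochizukiEtTh2009, Prop 4.3 (i) p.90] -/
theorem exists_HA_base_comm_of_galoisSurjNatural (hS : S.GaloisSurjNatural) (hA : S.IsGalois R.AN)
    (hB : S.IsGalois R.BN) (g : Aut R.BN.base) (hg : g ∈ S.HAbs R.BN hB) :
    ∃ h : S.HA R.AN hA, ModelFrobenioid.baseMap R.pair.num ≫ g.hom =
      (S.autBase R.AN (h : Aut R.AN)).hom ≫ ModelFrobenioid.baseMap R.pair.num := by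
  haveI : IsIso (ModelFrobenioid.baseMap R.pair.num) := R.pair.isPreStep_num.2
  have hmap := S.hAbs_map_conjAut_of_natural hS R.BN R.AN hB hA (asIso (ModelFrobenioid.baseMap R.pair.num))
  rw [← hmap] at hg
  obtain ⟨τ, hτ, hτg⟩ := Subgroup.mem_map.1 hg
  obtain ⟨σ, hσ⟩ := R.isSaturated.isAmple.surj hτ
  refine ⟨⟨σ, ?_⟩, ?_⟩
  · show σ ∈ (S.HAbs R.AN hA).comap (S.autBase R.AN)
    rw [Subgroup.mem_comap, hσ]
    exact hτ
  · have hστ : (S.autBase R.AN σ).hom = τ.hom := congrArg Iso.hom hσ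
    change ModelFrobenioid.baseMap R.pair.num ≫ g.hom = (S.autBase R.AN σ).hom ≫ ModelFrobenioid.baseMap R.pair.num
    rw [hστ, ← hτg]
    change (asIso (ModelFrobenioid.baseMap R.pair.num)).hom ≫
        ((asIso (ModelFrobenioid.baseMap R.pair.num)).conjAut τ).hom =
      τ.hom ≫ (asIso (ModelFrobenioid.baseMap R.pair.num)).hom
    rw [Iso.conjAut_hom, Iso.conj_apply, Iso.hom_inv_id_assoc]

end NthRoot

/-- **[EtTh] Proposition 4.3 (i) from `Φ` divisorial and the outer naturality of the Galois surjections**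
(Def. 4.1 (ii), `GaloisSurjNatural`), for EVERY transport `pullFrac`: abc-iut-L6-t12's `prop43_i_of'` with
its two base-level inputs `hα`, `hamp` discharged by the two theorems above.
[cite: MochizukiEtTh2009, Prop 4.3 (i) p.90–91] -/
theorem prop43_i_of_galoisSurjNatural
    (pullFrac : ∀ {A A' : S.C} (_ : A' ⟶ A), S.biratUnits A → S.biratUnits A')
    (hΦd : Objectwise (fun M _ => IsDivisorial M) S.tf.divisorMonoid) (hS : S.GaloisSurjNatural) :
    S.Prop43_i pullFrac :=
  S.prop43_i_of' pullFrac hΦd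
    (fun R hA striv hstriv hAo h => R.baseMap_striv_comp_α_of_galoisSurjNatural hS hA striv hstriv hAo h)
    (fun R hA hB _ g hg => R.exists_HA_base_comm_of_galoisSurjNatural hS hA hB g hg)

/-- **Prop. 4.3 (i) from "`C` is a Frobenioid" ([FrdI] Thm. 5.2 (ii), which makes `Φ` divisorial) and
`GaloisSurjNatural`**, every `pullFrac`. [cite: MochizukiEtTh2009, Prop 4.3 (i) p.90–91] -/
theorem prop43_i_of_isFrobenioid_of_galoisSurjNatural
    (pullFrac : ∀ {A A' : S.C} (_ : A' ⟶ A), S.biratUnits A → S.biratUnits A')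
    (hF : PreFrobenioid.IsFrobenioid S.F) (hS : S.GaloisSurjNatural) : S.Prop43_i pullFrac :=
  prop43_i_of_galoisSurjNatural pullFrac (fun W => hF.isPreFrobenioid.isDivisorial W) hS

end Abstract

/-- **Prop. 4.3 (i) at the tree's vocabulary** (`treeCatVocab`: `Φ` divisorial is automatic,
`isDivisorial_divisorMonoid`): the ONLY input is the outer naturality `GaloisSurjNatural` of Def. 4.1 (ii).
[cite: MochizukiEtTh2009, Prop 4.3 (i) p.90–91] -/
theorem prop43_i_of_tree_of_galoisSurjNatural
    {X : SemiGraphs.TemperedArithmeticGroup.{u₀} K} {D₀ : Type u₀} [Category.{v₀} D₀]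
    {V : FrdIMonoidStub.{w}} {T : RealifiedDivisorMonoids (D₀ := D₀) V} {D : Type u} [Category.{v} D]
    {IsRational IsStrictlyRational : (Dᵒᵖ ⥤ CommMonCat.{w}) → Prop}
    {S : BiKummerSetting X T D (treeCatVocab D IsRational IsStrictlyRational)}
    (pullFrac : ∀ {A A' : S.C} (_ : A' ⟶ A), S.biratUnits A → S.biratUnits A')
    (hS : S.GaloisSurjNatural) : S.Prop43_i pullFrac :=
  prop43_i_of_galoisSurjNatural pullFrac S.tf.isDivisorial_divisorMonoid hS

/-! ### The canonical model setting over the genuine temperoid `B^temp(Π^tp_X)` -/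

section Canonical

open Literature.AnabelianGeometry.SemiGraphs Literature.AnabelianGeometry.SemiGraphs.GaloisObjects

variable (X : SemiGraphs.TemperedArithmeticGroup.{u₀} K) {D₀ : Type u₀} [Category.{v₀} D₀]
  {V : FrdIMonoidStub.{w}} {T : RealifiedDivisorMonoids (D₀ := D₀) V}

/-- **[EtTh] Prop. 4.3 (i) PROVED for the canonical model setting over the genuine temperoid** — abc-iut-L2-t9's
`mkOfModelCanonical` on a tempered Frobenioid over `B^temp(Π^tp_X)` fed with the temperoid's Galois data
`(IsGaloisObj, galoisSurjOf)` (any saturation slot `NH`, any Frobenius-trivial Galois `A_⊙`), for EVERY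
transport `pullFrac`, given only `Φ` divisorial ([FrdI] Thm. 5.2 (ii) standing hypothesis): the naturality
input is abc-iut-w5-d013's theorem `mkOfModelCanonical_galoisSurjNatural`.
[cite: MochizukiEtTh2009, Prop 4.3 (i) p.90–91] -/
theorem prop43_i_mkOfModelCanonical {VD : FrdICatStub.{u₀ + 1, u₀, w} (BTemp X.Pi)}
    (tf : TemperedFrobenioid T (BTemp X.Pi) VD) (hZ : tf.monoidType = MonoidType.Z)
    (hP : ∀ A : (BTemp X.Pi)ᵒᵖ, IsPerfect (tf.Φ.carrier A))
    (NH : Subgroup (Field.absoluteGaloisGroup K) → tf.category → ℕ+ → Prop) (A₀ : tf.category)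
    (hA₀ : PreFrobenioid.IsFrobeniusTrivial tf.toElem A₀) (hA₀' : SemiGraphs.IsGaloisObj A₀.base)
    (hΦd : Objectwise (fun M _ => IsDivisorial M) tf.divisorMonoid)
    (pullFrac : ∀ {A A' : tf.category} (_ : A' ⟶ A), tf.biratUnitsModel A → tf.biratUnitsModel A') :
    (BiKummerSetting.mkOfModelCanonical X tf hZ hP SemiGraphs.IsGaloisObj
      (fun A h => galoisSurjOf X.isTempered A h) (fun A h => galoisSurjOf_surjective X.isTempered A h)
      NH A₀ hA₀ hA₀').Prop43_i (fun {_ _} φ x => pullFrac φ x) :=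
  prop43_i_of_galoisSurjNatural (fun {_ _} φ x => pullFrac φ x) hΦd
    (mkOfModelCanonical_galoisSurjNatural X tf hZ hP NH A₀ hA₀ hA₀')

/-- **[EtTh] Prop. 4.3 (i) PROVED, NO residual hypothesis, for the canonical model setting at the tree's
vocabulary** over the genuine temperoid (every `pullFrac`, `NH`, `A_⊙`): `Φ` divisorial is automatic there.
[cite: MochizukiEtTh2009, Prop 4.3 (i) p.90–91] -/
theorem prop43_i_mkOfModelCanonical_tree
    {IsRational IsStrictlyRational : ((BTemp X.Pi)ᵒᵖ ⥤ CommMonCat.{w}) → Prop}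
    (tf : TemperedFrobenioid T (BTemp X.Pi) (treeCatVocab (BTemp X.Pi) IsRational IsStrictlyRational))
    (hZ : tf.monoidType = MonoidType.Z) (hP : ∀ A : (BTemp X.Pi)ᵒᵖ, IsPerfect (tf.Φ.carrier A))
    (NH : Subgroup (Field.absoluteGaloisGroup K) → tf.category → ℕ+ → Prop) (A₀ : tf.category)
    (hA₀ : PreFrobenioid.IsFrobeniusTrivial tf.toElem A₀) (hA₀' : SemiGraphs.IsGaloisObj A₀.base)
    (pullFrac : ∀ {A A' : tf.category} (_ : A' ⟶ A), tf.biratUnitsModel A → tf.biratUnitsModel A') :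
    (BiKummerSetting.mkOfModelCanonical X tf hZ hP SemiGraphs.IsGaloisObj
      (fun A h => galoisSurjOf X.isTempered A h) (fun A h => galoisSurjOf_surjective X.isTempered A h)
      NH A₀ hA₀ hA₀').Prop43_i (fun {_ _} φ x => pullFrac φ x) :=
  prop43_i_mkOfModelCanonical X tf hZ hP NH A₀ hA₀ hA₀' tf.isDivisorial_divisorMonoid pullFrac

end Canonical

end BiKummerSetting

/-! ### The toy setting of `Sec4NonVacuity.lean` -/

namespace Toy

/-- **[EtTh] Prop. 4.3 (i) at the toy setting** `Toy.biKummerSetting` (perfect one-object toy, built through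
`mkOfModelCanonical`), every `pullFrac`: its Galois surjections satisfy `GaloisSurjNatural`
(`biKummerSetting_galoisSurjNatural`) and its `Φ = ℚ_{≥0}` is divisorial.
[cite: MochizukiEtTh2009, Prop 4.3 (i) p.90–91] -/
theorem prop43_i
    (pullFrac : ∀ {A A' : biKummerSetting.C} (_ : A' ⟶ A),
      biKummerSetting.biratUnits A → biKummerSetting.biratUnits A') :
    biKummerSetting.Prop43_i pullFrac :=
  BiKummerSetting.prop43_i_of_galoisSurjNatural pullFrac (fun A => divisorMonoidQ_isDivisorial A)
    biKummerSetting_galoisSurjNatural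

end Toy

end Literature.AnabelianGeometry.EtaleTheta

end
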